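import Literature.RepresentationTheory.FiniteGroups.SchurIndexOverSubfield
import Literature.Geometry.Kaehler.ComplexTorusGroupAlgebraSchurIndex
import HarnessLib

/-!
# The representation `k[G]f` afforded by a left ideal, its character `χ_{k[G]f}(g) = Σ_h f(h⁻¹g⁻¹h)`,
# the multiplicity `⟨χ_{k[G]f}, χ⟩ = Σ_g f_g χ(g)`, and the agreement `schurIndex χ = m_ℚ(χ)` of the tree's
# two Schur indices over `ℚ` (Isaacs, *Character Theory of Finite Groups*, Def. 10.1, Cor. 10.2;
# Lange–Rodríguez, *Decomposition of Jacobians by Prym Varieties*, §2.8 (2.20), Prop. 2.8.5, §2.9.1)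

Topic `RepresentationTheory/FiniteGroups`; namespace `Literature.RepresentationTheory.FiniteGroups`.
One definition with a body (`idealSubrep k f`, the left ideal `k[G]f` as a `Subrepresentation` of
Mathlib's regular representation `Representation.ofMulAction k G G` on `k[G]`), **no named fact, no
`sorry`**.  It joins two strands of the tree: `schurIndex χ` (`Geometry/Kaehler/ComplexTorusGroupAlgebraSchurIndex`,
lane A2 junction, defined through rational idempotents: the least positive `Σ_g f_g χ(g)`, `f² = f ∈ ℚ[G]`)
and `schurIndexOver K ψ` (`SchurIndexOverSubfield`, defined through `K`-representations: the least
positive `⟨χ_W, ψ⟩`).  They agree for `K = ℚ` (`schurIndex_eq_schurIndexOver`), so every result of either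
file is available for the other (samples in §3).

Sources.  Isaacs (held `book:isaacsnd-character-theory-finite-groups`, p0159–p0160): Def. 10.1 ("the
multiplicity of `𝔛` as a constituent of `𝔜^E` is the *Schur index*"), Cor. 10.2 (b) ("`m_F(χ)(Σ𝒮)` is
the character of an irreducible `F`-representation"), (c), (e).  Lange–Rodríguez (held
`book:lange2022-decomposition-jacobians-by-prym-varieties`, p0039–p0044): (2.20) "`W ⊗ L ≃ s ⊕_γ V^γ`",
Prop. 2.8.5 "`ℚ[G]f_{H,W} ≃ (dim V^H/s) W`", (2.31) "`W = ℚ[G]q`" for a primitive idempotent `q`.  Isaacs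
Problem 4.7 (the character afforded by `PW` is `g ↦ tr(gP)` for an idempotent `P` commuting with `G`).

## What is proved

* §1 (any field `k`, any `f ∈ k[G]`): `idealSubrep k f` (on `range (· f) = k[G]f`), `ofMulAction_apply_eq_of_mul`
  (`ρ_reg(g)x = g·x`), `mem_idealSubrep_iff` (`x ∈ k[G]f ↔ xf = x`, `f` idempotent), `coe_idealSubrep_apply`,
  **`character_idealSubrep`** (`χ_{k[G]f}(g) = Σ_h f(h⁻¹g⁻¹h)`: trace of `x ↦ gxf`, via the tree's
  `trace_restrict_range_eq_trace_mul` and the standard basis of `k[G]`),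
  **`classInner_character_idealSubrep`** (`⟨χ_{k[G]f}, χ⟩ = Σ_g f_g χ(g)` in `ℂ` for every class function `χ`,
  `k → ℂ`).
* §2 **`isIrreducible_idealSubrep`**: `k[G]f` is an irreducible representation whenever the left ideal
  `k[G]f` is a simple `k[G]`-module (its `asModule` structure is identified with the ideal).
* §3 (`k = ℚ`) **`schurIndex_eq_schurIndexOver`** (`schurIndex χ = schurIndexOver ℚ χ` for `χ ∈ Irr(G)`:
  a primitive idempotent `q` of the Wedderburn block of `χ` affords the IRREDUCIBLE `ℚ[G]q` with
  multiplicity `Σ_g q_g χ(g) = schurIndex χ`, and the multiplicity in the irreducible rational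
  representation containing `χ` is `m_ℚ(χ)` by Cor. 10.2 (e)); transfers:
  `exists_classInner_eq_natCast_mul_schurIndex` (Cor. 10.2 (c) for `schurIndex` and arbitrary rational
  representations), `schurIndex_eq_one_of_commGroup`, `schurIndex_galPowTwist`.

## References

* I. M. Isaacs, *Character Theory of Finite Groups*, Academic Press (1976), Lemma 2.10 (p0024), Problem 4.7,
  Def. 10.1 (p0159), Cor. 10.2 (p0160). [Isaacs1976]
* H. Lange, R. E. Rodríguez, *Decomposition of Jacobians by Prym Varieties*, LNM 2310, Springer (2022),
  §2.8 (2.20), Prop. 2.8.5, §2.9.1 (2.29)–(2.31) (p0039–p0044). [LangeRodriguez2022]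
* J.-P. Serre, *Linear Representations of Finite Groups*, GTM 42 (1977), §12.2 (p0080), §12.5 (p0084).
  [SerreLinearRepresentations1977]
-/

noncomputable section

open scoped BigOperators
open Module

namespace Literature.RepresentationTheory.FiniteGroups

/-! ## §1 The left ideal `k[G]f` as a subrepresentation of the regular representation -/

section IdealRep

variable (k : Type) [Field k] {G : Type} [Group G]

/-- The regular representation is left multiplication: `ρ_reg(g) x = g · x` in `k[G]` (for `k = ℂ` the
tree's `leftRegular_apply_eq_of_mul`). [cite: Isaacs1976, Lemma 2.10 (p0024)] -/
theorem ofMulAction_apply_eq_of_mul (g : G) (x : MonoidAlgebra k G) :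
    Representation.ofMulAction k G G g x = MonoidAlgebra.of k G g * x := by
  induction x using MonoidAlgebra.induction_linear with
  | zero => rw [map_zero, mul_zero]
  | add x y hx hy => rw [map_add, mul_add, hx, hy]
  | single h r =>
    rw [Representation.ofMulAction_single, smul_eq_mul, MonoidAlgebra.of_apply,
      MonoidAlgebra.single_mul_single, one_mul]

/-- **The left ideal `k[G]f` as a representation of `G` over `k`**: the sub-representation of the left
regular representation of `G` on `k[G]` carried by the `k`-subspace `k[G]·f = {x f}` (Isaacs: "an
`F`-representation […] corresponding to the left ideal"; Lange–Rodríguez's `ℚ[G]f`).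
[cite: Isaacs1976, Def. 10.1 and Cor. 10.2 (b) (p0159–p0160)] [cite: LangeRodriguez2022, §2.8 Prop. 2.8.5 (p0042)] -/
def idealSubrep (f : MonoidAlgebra k G) : Subrepresentation (Representation.ofMulAction k G G) where
  toSubmodule := LinearMap.range (LinearMap.mulRight k f)
  apply_mem_toSubmodule g x hx := by
    obtain ⟨y, rfl⟩ := hx
    refine ⟨MonoidAlgebra.of k G g * y, ?_⟩
    rw [LinearMap.mulRight_apply, LinearMap.mulRight_apply, ofMulAction_apply_eq_of_mul, mul_assoc]

/-- Unfolding: the underlying subspace of `k[G]f` is the range of right multiplication by `f`.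
[cite: LangeRodriguez2022, §2.8 Prop. 2.8.5 (`ℚ[G]f`, p0042)] -/
theorem idealSubrep_toSubmodule (f : MonoidAlgebra k G) :
    (idealSubrep k f).toSubmodule = LinearMap.range (LinearMap.mulRight k f) := rfl

/-- For an idempotent `f`: `x ∈ k[G]f ↔ x f = x`. [cite: LangeRodriguez2022, §2.8 (p0042)] -/
theorem mem_idealSubrep_iff {f : MonoidAlgebra k G} (hf : IsIdempotentElem f) {x : MonoidAlgebra k G} :
    x ∈ (idealSubrep k f).toSubmodule ↔ x * f = x := by
  constructor
  · rintro ⟨y, rfl⟩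
    rw [LinearMap.mulRight_apply, mul_assoc, hf.eq]
  · intro h
    exact ⟨x, h⟩

/-- The action on `k[G]f` is left multiplication. [cite: Isaacs1976, Lemma 2.10 (p0024)] -/
theorem coe_idealSubrep_apply (f : MonoidAlgebra k G) (g : G) (x : (idealSubrep k f).toSubmodule) :
    ((idealSubrep k f).toRepresentation g x : MonoidAlgebra k G) = MonoidAlgebra.of k G g * x := by
  change Representation.ofMulAction k G G g x = _
  exact ofMulAction_apply_eq_of_mul k g x

variable [Fintype G]

/-- **The character of `k[G]f`: `χ_{k[G]f}(g) = Σ_h f(h⁻¹ g⁻¹ h)`** for an idempotent `f` (the trace of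
`x ↦ g x f` on `k[G]`, which is `x ↦ g x` on `k[G]f` and `0` on `k[G](1 - f)`).
[cite: Isaacs1976, Problem 4.7 and Lemma 2.10 (p0024)] -/
theorem character_idealSubrep {f : MonoidAlgebra k G} (hf : IsIdempotentElem f) (g : G) :
    (idealSubrep k f).toRepresentation.character g = ∑ h : G, f.coeff (h⁻¹ * g⁻¹ * h) := by
  classical
  haveI : Module.Finite k (MonoidAlgebra k G) := Module.Finite.of_basis (MonoidAlgebra.basis G k)
  have hP : IsIdempotentElem (LinearMap.mulRight k f : Module.End k (MonoidAlgebra k G)) :=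
    LinearMap.ext fun x => by
      change x * f * f = x * f
      rw [mul_assoc, hf.eq]
  have hTP : Representation.ofMulAction k G G g * LinearMap.mulRight k f =
      LinearMap.mulRight k f * Representation.ofMulAction k G G g :=
    LinearMap.ext fun x => by
      change Representation.ofMulAction k G G g (x * f) = Representation.ofMulAction k G G g x * f
      rw [ofMulAction_apply_eq_of_mul, ofMulAction_apply_eq_of_mul, mul_assoc]
  have h : LinearMap.trace k _ ((idealSubrep k f).toRepresentation g) =
      LinearMap.trace k (MonoidAlgebra k G) (Representation.ofMulAction k G G g * LinearMap.mulRight k f) :=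
    trace_restrict_range_eq_trace_mul hP hTP
  show LinearMap.trace k _ ((idealSubrep k f).toRepresentation g) = _
  rw [h, LinearMap.trace_eq_matrix_trace k (MonoidAlgebra.basis G k), Matrix.trace]
  refine Finset.sum_congr rfl fun x _ => ?_
  rw [Matrix.diag_apply, LinearMap.toMatrix_apply, MonoidAlgebra.basis_apply]
  change ((Representation.ofMulAction k G G g (MonoidAlgebra.single x 1 * f)).coeff) x = _
  rw [ofMulAction_apply_eq_of_mul, MonoidAlgebra.of_apply, MonoidAlgebra.coeff_single_mul_apply,
    MonoidAlgebra.coeff_single_mul_apply, one_mul, one_mul, mul_assoc]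

/-- **The multiplicity of a complex class function `χ` in `k[G]f` (read in `ℂ`) is `Σ_g f_g χ(g)`**:
`⟨χ_{k[G]f}, χ⟩ = Σ_g f_g χ(g)` — for `χ ∈ Irr(G)` this is `dim_ℂ f V_χ = tr ρ_χ(f)`, the number of times
`V_χ` occurs in `k[G]f ⊗ ℂ` (Lange–Rodríguez (2.20)/Prop. 2.8.5; the multiplicity used to DEFINE the
tree's `ℚ`-Schur index `schurIndex`). [cite: LangeRodriguez2022, §2.8 (2.20) and Prop. 2.8.5 (p0039, p0042)]
[cite: Isaacs1976, Cor. 10.2 (c) (p0160)] -/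
theorem classInner_character_idealSubrep [Algebra k ℂ] {f : MonoidAlgebra k G} (hf : IsIdempotentElem f)
    {χ : G → ℂ} (hχ : IsClassFun χ) :
    classInner (fun s => algebraMap k ℂ ((idealSubrep k f).toRepresentation.character s)) χ =
      ∑ g : G, algebraMap k ℂ (f.coeff g) * χ g := by
  rw [classInner_apply]
  simp_rw [character_idealSubrep k hf, map_sum, Finset.sum_mul]
  rw [Finset.sum_comm]
  -- for each `h`, reindex `s ↦ h⁻¹ s⁻¹ h`
  have hinner : ∀ h : G, ∑ s : G, algebraMap k ℂ (f.coeff (h⁻¹ * s⁻¹ * h)) * χ s⁻¹ =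
      ∑ g : G, algebraMap k ℂ (f.coeff g) * χ g := fun h => by
    refine Fintype.sum_equiv (((Equiv.inv G).trans (Equiv.mulLeft h⁻¹)).trans (Equiv.mulRight h)) _ _
      fun s => ?_
    simp only [Equiv.trans_apply, Equiv.inv_apply, Equiv.coe_mulLeft, Equiv.coe_mulRight]
    rw [hχ.apply_inv_mul_mul s⁻¹ h]
  rw [Finset.sum_congr rfl fun h _ => hinner h, Finset.sum_const, Finset.card_univ, nsmul_eq_mul,
    ← mul_assoc, inv_mul_cancel₀ (Nat.cast_ne_zero.mpr Fintype.card_ne_zero), one_mul]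

end IdealRep


/-! ## §2 `k[G]f` is irreducible when the left ideal `k[G]f` is a simple `k[G]`-module -/

section Irreducible

variable (k : Type) [Field k] {G : Type} [Group G]

/-- For an idempotent `f`, the range of `x ↦ x f` is the left ideal `k[G]f` generated by `f`.
[cite: LangeRodriguez2022, §2.8 Prop. 2.8.5 and §2.9.1 (2.31) (`ℚ[G]f`, `ℚ[G]q`, p0042–p0044)] -/
theorem mem_idealSubrep_iff_mem_span {f : MonoidAlgebra k G} (hf : IsIdempotentElem f) (x : MonoidAlgebra k G) :
    x ∈ (idealSubrep k f).toSubmodule ↔ x ∈ Ideal.span ({f} : Set (MonoidAlgebra k G)) := by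
  rw [mem_idealSubrep_iff k hf, Ideal.mem_span_singleton']
  exact ⟨fun h => ⟨x, h⟩, fun ⟨a, ha⟩ => by rw [← ha, mul_assoc, hf.eq]⟩

/-- **The representation `k[G]f` is irreducible as soon as the left ideal `k[G]f` is a simple
`k[G]`-module** (e.g. `f` a primitive idempotent): its `k[G]`-module structure IS that of the ideal
(`G` acts by left multiplication), and irreducibility is simplicity of the `k[G]`-module (Mathlib's
`irreducible_iff_isSimpleModule_asModule`). [cite: Isaacs1976, Cor. 10.2 (b) ("an irreducible `F`-representation", p0160)]
[cite: LangeRodriguez2022, §2.9.1 (2.31) (`W = ℚ[G]q` irreducible), p0044] -/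
theorem isIrreducible_idealSubrep {f : MonoidAlgebra k G} (hf : IsIdempotentElem f)
    (hs : IsSimpleModule (MonoidAlgebra k G) (Ideal.span ({f} : Set (MonoidAlgebra k G)))) :
    (idealSubrep k f).toRepresentation.IsIrreducible := by
  let σ := (idealSubrep k f).toRepresentation
  have hmem := mem_idealSubrep_iff_mem_span k hf
  have hsmul : ∀ (a : MonoidAlgebra k G) (x : (idealSubrep k f).toSubmodule),
      ((σ.asAlgebraHom a x : (idealSubrep k f).toSubmodule) : MonoidAlgebra k G) = a * x := by
    intro a x
    induction a using MonoidAlgebra.induction_on with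
    | hM g => rw [Representation.asAlgebraHom_of, coe_idealSubrep_apply]
    | hadd a b ha hb => rw [map_add, LinearMap.add_apply, Submodule.coe_add, ha, hb, add_mul]
    | hsmul r a ha => rw [map_smul, LinearMap.smul_apply, Submodule.coe_smul, ha, smul_mul_assoc]
  let e : σ.asModule ≃ₗ[MonoidAlgebra k G] Ideal.span ({f} : Set (MonoidAlgebra k G)) :=
    { toFun := fun x => ⟨(σ.asModuleEquiv x : MonoidAlgebra k G), (hmem _).mp (σ.asModuleEquiv x).2⟩
      invFun := fun y => σ.asModuleEquiv.symm ⟨y.1, (hmem _).mpr y.2⟩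
      map_add' := fun _ _ => rfl
      map_smul' := fun a x => Subtype.ext (by
        change ((σ.asModuleEquiv (a • x) : _) : MonoidAlgebra k G) = a * (σ.asModuleEquiv x : MonoidAlgebra k G)
        rw [Representation.asModuleEquiv_map_smul]
        exact hsmul a _)
      left_inv := fun _ => rfl
      right_inv := fun _ => rfl }
  rw [Representation.irreducible_iff_isSimpleModule_asModule]
  haveI := hs
  exact IsSimpleModule.congr e

end Irreducible

/-! ## §3 `K = ℚ`: the two Schur indices of the tree agree -/

section Rational

variable {G : Type} [Group G] [Fintype G]

/-- **`schurIndex χ = m_ℚ(χ)`: the tree's `ℚ`-Schur index** (`Geometry/Kaehler/ComplexTorusGroupAlgebraSchurIndex`: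
the least positive multiplicity `Σ_g f_g χ(g)` of `χ` in a CYCLIC rational representation `ℚ[G]f`, `f² = f`)
**equals the Schur index over `ℚ`** of `SchurIndexOverSubfield` (the least positive multiplicity in ANY
rational representation; Isaacs' `m_ℚ(χ)`).  Proof: a primitive idempotent `q` of the block of `χ` in a
Wedderburn presentation of `ℚ[G]` affords the irreducible representation `ℚ[G]q` with
`⟨χ_{ℚ[G]q}, χ⟩ = Σ_g q_g χ(g) = schurIndex χ` (§1, `schurIndex_eq_sum_coeff_unitIdempotent`), and the
multiplicity of `χ` in the irreducible rational representation containing it is `m_ℚ(χ)`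
(`classInner_eq_schurIndexOver`, Cor. 10.2 (e)). [cite: Isaacs1976, Def. 10.1 and Cor. 10.2 (b), (e) (p0159–p0160)]
[cite: LangeRodriguez2022, §2.8 (2.20) and §2.9.1 (2.31), p0039, p0044] -/
theorem schurIndex_eq_schurIndexOver {χ : G → ℂ} (hχ : IsIrrChar G χ) : schurIndex χ = schurIndexOver ℚ χ := by
  classical
  obtain ⟨r, n, D, _, _, _, hn, ⟨e⟩⟩ := exists_wedderburnPresentation G
  haveI : ∀ i, NeZero (n i) := hn
  obtain ⟨i, hi, -⟩ := existsUnique_blockIdempotent_eq_ratCharIdempotent e hχ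
  haveI : Module.Finite ℚ (MonoidAlgebra ℚ G) := Module.Finite.of_basis (MonoidAlgebra.basis G ℚ)
  have hq : IsIdempotentElem (unitIdempotent e i (blockZero n i)) := isIdempotentElem_unitIdempotent e i _
  haveI : (idealSubrep ℚ (unitIdempotent e i (blockZero n i))).toRepresentation.IsIrreducible :=
    isIrreducible_idealSubrep ℚ hq (isSimpleModule_columnIdeal e i _)
  have hmult : classInner (fun s => algebraMap ℚ ℂ
      ((idealSubrep ℚ (unitIdempotent e i (blockZero n i))).toRepresentation.character s)) χ = schurIndex χ := by
    rw [classInner_character_idealSubrep ℚ hq hχ.isCharacter.isClassFun,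
      schurIndex_eq_sum_coeff_unitIdempotent e hχ hi (blockZero n i)]
    simp_rw [eq_ratCast]
  have hne : classInner (fun s => algebraMap ℚ ℂ
      ((idealSubrep ℚ (unitIdempotent e i (blockZero n i))).toRepresentation.character s)) χ ≠ 0 := by
    rw [hmult]
    exact_mod_cast (schurIndex_pos hχ).ne'
  have h := classInner_eq_schurIndexOver ℚ
    (idealSubrep ℚ (unitIdempotent e i (blockZero n i))).toRepresentation hχ hne
  rw [hmult, Nat.cast_inj] at h
  exact h

/-- Hence **Cor. 10.2 (c) for the tree's `schurIndex` and ARBITRARY rational representations**: `schurIndex χ`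
divides the multiplicity `⟨χ_W, χ⟩` of `χ` in every representation `W` of `G` over `ℚ` (not only in the
cyclic ones `ℚ[G]f`). [cite: Isaacs1976, Cor. 10.2 (c) (p0160)] -/
theorem exists_classInner_eq_natCast_mul_schurIndex {χ : G → ℂ} (hχ : IsIrrChar G χ) {W : Type}
    [AddCommGroup W] [Module ℚ W] [FiniteDimensional ℚ W] (ρW : Representation ℚ G W) :
    ∃ a : ℕ, classInner (fun s => algebraMap ℚ ℂ (ρW.character s)) χ = a * schurIndex χ := by
  rw [schurIndex_eq_schurIndexOver hχ]
  exact exists_classInner_eq_natCast_mul_schurIndexOver ℚ ρW hχ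

/-- Hence the tree's `ℚ`-Schur index is `1` for abelian groups. [cite: SerreLinearRepresentations1977, §12.5 (p0084)] -/
theorem schurIndex_eq_one_of_commGroup {A : Type} [CommGroup A] [Fintype A] {χ : A → ℂ} (hχ : IsIrrChar A χ) :
    schurIndex χ = 1 := by
  rw [schurIndex_eq_schurIndexOver hχ, schurIndexOver_eq_one_of_commGroup ℚ hχ]

/-- Hence the tree's `ℚ`-Schur index is constant on Galois conjugacy classes read through `σ_t`:
`schurIndex (σ_t χ) = schurIndex χ`. [cite: Isaacs1976, Cor. 10.2 (b) (p0160)] -/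
theorem schurIndex_galPowTwist {L : Type} [Field L] [Algebra ℚ L] [Algebra L ℂ] {m : ℕ} [NeZero m] {ζ : L}
    (hζ : IsPrimitiveRoot ζ m) (hm : Monoid.exponent G ∣ m) {χ : G → ℂ} (hχ : IsIrrChar G χ) (σ : L ≃ₐ[ℚ] L) :
    schurIndex (galPowTwist ℚ hζ σ χ) = schurIndex χ := by
  rw [schurIndex_eq_schurIndexOver hχ,
    schurIndex_eq_schurIndexOver ((isIrrChar_galPowTwist_iff ℚ hζ hm σ χ).mpr hχ),
    schurIndexOver_galPowTwist ℚ hζ hm hχ σ]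

end Rational

end Literature.RepresentationTheory.FiniteGroups

end
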